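import Mathlib.GroupTheory.SpecificGroups.Dihedral
import Mathlib.Data.ZMod.Basic
import Mathlib.Tactic
import Literature.Combinatorics.Additive.TripleProductProperty
import Literature.Computability.AlgebraicComplexity.CohnUmansTPP
import HarnessLib
import Summits.MatrixMultiplication.OmegaCensus.CyclicDihedralIndexTwoFamily

/-!
# Cyclic × dihedral index-2 families, part 2: `C_{2h+1} × D_{2(2h+1)}` and the diagonal family

Continuation of `CyclicDihedralIndexTwoFamily.lean` (source: speedrun lane `tpp`, seat `sr-tpp-search-g10`, tree-ready file v4
sha256 `6da5cbb8bc90032184cc9ca72310b88096c9c8c6bbd0a339081b60eedce46753`; split at section boundaries by the cell `pub-omega`, seat pub-omega-group-g3, ruling L5-9 (2), for the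
400-line rule; a docstring added to every declaration; statements and proofs verbatim).  Contents: section `family0` — the abelian non-cyclic-index-2 class `C_{2h+1} × D_{2(2h+1)} ⊇ ⟨2h, 4, 2h⟩` (volume `16h² = 2|G| − (16h+4)`); section `diag` — the diagonal family `(2m+1, 4m, 2)` in `C_{2m+1} × D_{2(2m+1)}`.
HONEST FRAMING: explicit TPP families (census lower bounds); nothing on `ω`.
Framing: lottery ticket; floor = certified bounds/negative ranges.
-/

namespace Summit.MatrixMultiplication.OmegaCensus.CyclicDihedralIndexTwoFamily

open Literature.Computability.AlgebraicComplexity Literature.Combinatorics.Additive DihedralGroup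

variable {K M : ℕ}
section family0
variable (h : ℕ)

/-- `S0 = { (−i, r i) : i < 2h }` in `C_{2h+1} × D_{2(2h+1)}`. -/
def S0 : Finset (Grp (2 * h + 1) (2 * h + 1)) :=
  (Finset.range (2 * h)).image fun i : ℕ => rot (2 * h + 1) (2 * h + 1) (-(i : ℤ)) (i : ℤ)
/-- `T = { 1, (1, r 1), (1, sr 1), (0, sr 2) }`. -/
def T0 : Finset (Grp (2 * h + 1) (2 * h + 1)) :=
  {rot (2 * h + 1) (2 * h + 1) 0 0, rot (2 * h + 1) (2 * h + 1) 1 1, ref (2 * h + 1) (2 * h + 1) 1 1,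
    ref (2 * h + 1) (2 * h + 1) 0 2}
/-- `U = { (−2j, r (−4−2j)) : j < h } ∪ { (−2i, sr (2i)) : i < h }`. -/
def U0 : Finset (Grp (2 * h + 1) (2 * h + 1)) :=
  ((Finset.range h).image fun j : ℕ => rot (2 * h + 1) (2 * h + 1) (-(2 * j : ℤ)) (-(4 + 2 * j : ℤ))) ∪
  ((Finset.range h).image fun i : ℕ => ref (2 * h + 1) (2 * h + 1) (-(2 * i : ℤ)) (2 * i : ℤ))

/-- `|S0 h| = 2h`. [folklore] -/
theorem card_S0 : (S0 h).card = 2 * h := by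
  rw [S0, Finset.card_image_of_injOn, Finset.card_range]
  intro i hi i' hi' he
  simp only [Finset.coe_range, Set.mem_Iio] at hi hi'
  have he' := (rot_eq_rot_iff _ _ _ _).mp he
  obtain ⟨hA, -⟩ := he'
  have hK : (0 : ℤ) < ((2 * h + 1 : ℕ) : ℤ) := by positivity
  rcases dvd_window2 hK hA (by push_cast; omega) (by push_cast; omega) with hA | hA | hA <;>
    (push_cast at hA; omega)

/-- `|T0 h| = 4` (for `h ≥ 1`). [folklore] -/
theorem card_T0 (hh : 1 ≤ h) : (T0 h).card = 4 := by
  have h1 : ¬ (2 * (h : ℤ) + 1 ∣ 1) := by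
    intro hd; have := Int.le_of_dvd one_pos hd; omega
  have d1 : rot (2 * h + 1) (2 * h + 1) 0 0 ≠ rot (2 * h + 1) (2 * h + 1) 1 1 := by
    rw [Ne, rot_eq_rot_iff]; push_cast; simp [h1]
  have d2 : rot (2 * h + 1) (2 * h + 1) 0 0 ≠ ref (2 * h + 1) (2 * h + 1) 1 1 := by simp
  have d3 : rot (2 * h + 1) (2 * h + 1) 0 0 ≠ ref (2 * h + 1) (2 * h + 1) 0 2 := by simp
  have d4 : rot (2 * h + 1) (2 * h + 1) 1 1 ≠ ref (2 * h + 1) (2 * h + 1) 1 1 := by simp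
  have d5 : rot (2 * h + 1) (2 * h + 1) 1 1 ≠ ref (2 * h + 1) (2 * h + 1) 0 2 := by simp
  have d6 : ref (2 * h + 1) (2 * h + 1) 1 1 ≠ ref (2 * h + 1) (2 * h + 1) 0 2 := by
    rw [Ne, ref_eq_ref_iff]; push_cast; simp [h1]
  simp only [T0]
  rw [Finset.card_insert_of_notMem (by simp only [Finset.mem_insert, Finset.mem_singleton]; push Not; exact ⟨d1, d2, d3⟩),
    Finset.card_insert_of_notMem (by simp only [Finset.mem_insert, Finset.mem_singleton]; push Not; exact ⟨d4, d5⟩),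
    Finset.card_pair d6]

/-- `|U0 h| = 2h`. [folklore] -/
theorem card_U0 : (U0 h).card = 2 * h := by
  have hK : (0 : ℤ) < ((2 * h + 1 : ℕ) : ℤ) := by positivity
  rw [U0, Finset.card_union_of_disjoint, Finset.card_image_of_injOn, Finset.card_image_of_injOn, Finset.card_range]
  · omega
  · intro i hi i' hi' he
    simp only [Finset.coe_range, Set.mem_Iio] at hi hi'
    obtain ⟨hA, -⟩ := (ref_eq_ref_iff _ _ _ _).mp he
    rcases dvd_window2 hK hA (by push_cast; omega) (by push_cast; omega) with hA | hA | hA <;>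
      (push_cast at hA; omega)
  · intro i hi i' hi' he
    simp only [Finset.coe_range, Set.mem_Iio] at hi hi'
    obtain ⟨hA, -⟩ := (rot_eq_rot_iff _ _ _ _).mp he
    rcases dvd_window2 hK hA (by push_cast; omega) (by push_cast; omega) with hA | hA | hA <;>
      (push_cast at hA; omega)
  · rw [Finset.disjoint_left]
    intro x hx hx'
    simp only [Finset.mem_image, Finset.mem_range] at hx hx'
    obtain ⟨j, -, rfl⟩ := hx
    obtain ⟨i, -, hc⟩ := hx'
    simp at hc

set_option maxHeartbeats 0 in
/-- **The triple `(S0 h, T0 h, U0 h)` has the triple product property** in `C_{2h+1} × D_{2(2h+1)}` (`h ≥ 1`). [folklore] -/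
theorem tpp0 (hh : 1 ≤ h) :
    ∀ s ∈ S0 h, ∀ s' ∈ S0 h, ∀ t ∈ T0 h, ∀ t' ∈ T0 h, ∀ u ∈ U0 h, ∀ u' ∈ U0 h,
      s * s'⁻¹ * (t * t'⁻¹) * (u * u'⁻¹) = 1 → s = s' ∧ t = t' ∧ u = u' := by
  have hK : (0 : ℤ) < ((2 * h + 1 : ℕ) : ℤ) := by positivity
  have hM : (0 : ℤ) < ((2 * h + 1 : ℕ) : ℤ) := by positivity
  intro s hs s' hs' t ht t' ht' u hu u' hu' he
  simp only [S0, T0, U0, Finset.mem_image, Finset.mem_range, Finset.mem_union, Finset.mem_insert,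
    Finset.mem_singleton] at hs hs' ht ht' hu hu'
  obtain ⟨i, hi, rfl⟩ := hs
  obtain ⟨i', hi', rfl⟩ := hs'
  rcases ht with rfl | rfl | rfl | rfl <;> rcases ht' with rfl | rfl | rfl | rfl <;>
  rcases hu with ⟨j, hj, rfl⟩ | ⟨j, hj, rfl⟩ <;> rcases hu' with ⟨j', hj', rfl⟩ | ⟨j', hj', rfl⟩ <;>
  simp only [rot_mul_rot, rot_mul_ref, ref_mul_rot, ref_mul_ref, rot_inv, ref_inv, rot_eq_one_iff,
    ref_ne_one] at he
  all_goals (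
    obtain ⟨hA, hB⟩ := he
    rcases dvd_window2 hK hA (by omega) (by omega) with hA | hA | hA <;>
    rcases dvd_window6 hM hB (by omega) (by omega) with hB | hB | hB | hB | hB | hB | hB | hB | hB | hB | hB <;>
    first
      | (exfalso; omega)
      | (obtain rfl : i = i' := by omega
         obtain rfl : j = j' := by omega
         exact ⟨rfl, rfl, rfl⟩))

/-- **The second family** (`K = M`): for every `h ≥ 1`, `C_{2h+1} × D_{2(2h+1)}` realizes `⟨2h, 4, 2h⟩`. -/
theorem realizesTPP_family0 (hh : 1 ≤ h) :
    RealizesTPP (Grp (2 * h + 1) (2 * h + 1)) (2 * h) 4 (2 * h) :=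
  ⟨S0 h, T0 h, U0 h, card_S0 h, card_T0 h hh, card_U0 h, tpp0 h hh⟩

/-- `TripleProductProperty` form of `tpp0`. [folklore] -/
theorem tripleProductProperty_family0 (hh : 1 ≤ h) : TripleProductProperty (S0 h) (T0 h) (U0 h) := tpp0 h hh

/-- Existence form: a TPP triple of sizes `(2h, 4, 2h)` in `C_{2h+1} × D_{2(2h+1)}`. [folklore] -/
theorem exists_tpp_family0 (hh : 1 ≤ h) : ∃ A B C : Finset (Grp (2 * h + 1) (2 * h + 1)),
    TripleProductProperty A B C ∧ A.card = 2 * h ∧ B.card = 4 ∧ C.card = 2 * h :=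
  ⟨S0 h, T0 h, U0 h, tpp0 h hh, card_S0 h, card_T0 h hh, card_U0 h⟩

/-- `|C_{2h+1} × D_{2(2h+1)}| = 2(2h+1)²`. [folklore] -/
theorem card_Grp0 : Fintype.card (Grp (2 * h + 1) (2 * h + 1)) = 2 * (2 * h + 1) * (2 * h + 1) := by
  simp [Fintype.card_prod, ZMod.card, DihedralGroup.card]; ring

/-- Summary for the abelian-index-2 family `C_M × D_{2M}` (`M = 2h+1`): order `2M² = 8h²+8h+2` and a TPP triple of
volume `(2h)·4·(2h) = 2|G| − (16h+4)`, ratio `→ 2`. -/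
theorem family_summary0 (hh : 1 ≤ h) :
    Fintype.card (Grp (2 * h + 1) (2 * h + 1)) = 8 * h ^ 2 + 8 * h + 2 ∧
    RealizesTPP (Grp (2 * h + 1) (2 * h + 1)) (2 * h) 4 (2 * h) ∧
    (2 * h) * 4 * (2 * h) + (16 * h + 4) = 2 * (8 * h ^ 2 + 8 * h + 2) :=
  ⟨by rw [card_Grp0]; ring, realizesTPP_family0 h hh, by ring⟩

end family0


section diag
variable (m : ℕ)

/-! ### The diagonal family `⟨M, 2M−2, 2⟩` in `C_M × D_{2M}` (`M = 2m+1` odd), volume `4M(M−1) = 2|G| − 4M`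

`Sd = {(i, r(−i))}` is the anti-diagonal subgroup of order `M`; `Td = {(x, r x), (x, sr(−x)) : x ≠ 0}`; `Ud = {1, (0, sr 0)}`.
Exact-census remark (lane tpp, orders ≤ 127): `4K(M−1)` is the exact TPP capacity of `C_K × D_{2M}` for every odd `M ∣ K`
with `2KM ≤ 127` (`(K,M) = (3,3),(6,3),(9,3),(12,3),(15,3),(18,3),(21,3),(5,5),(10,5),(7,7)`); here the case `K = M` is
kernel-checked for all `m`. -/

/-- the anti-diagonal subgroup `{(i, r(−i)) : i < M}`. -/
def Sd : Finset (Grp (2 * m + 1) (2 * m + 1)) :=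
  (Finset.range (2 * m + 1)).image fun i : ℕ => rot (2 * m + 1) (2 * m + 1) (i : ℤ) (-(i : ℤ))
/-- `{(x, r x) : 1 ≤ x ≤ M−1} ∪ {(x, sr(−x)) : 1 ≤ x ≤ M−1}`. -/
def Td : Finset (Grp (2 * m + 1) (2 * m + 1)) :=
  ((Finset.range (2 * m)).image fun x : ℕ => rot (2 * m + 1) (2 * m + 1) ((x : ℤ) + 1) ((x : ℤ) + 1)) ∪
  ((Finset.range (2 * m)).image fun x : ℕ => ref (2 * m + 1) (2 * m + 1) ((x : ℤ) + 1) (-((x : ℤ) + 1)))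
/-- `{1, (0, sr 0)}`. -/
def Ud : Finset (Grp (2 * m + 1) (2 * m + 1)) :=
  {rot (2 * m + 1) (2 * m + 1) 0 0, ref (2 * m + 1) (2 * m + 1) 0 0}

/-- `|Sd m| = 2m + 1`. [folklore] -/
theorem card_Sd : (Sd m).card = 2 * m + 1 := by
  rw [Sd, Finset.card_image_of_injOn, Finset.card_range]
  intro i hi i' hi' he
  simp only [Finset.coe_range, Set.mem_Iio] at hi hi'
  obtain ⟨hA, -⟩ := (rot_eq_rot_iff _ _ _ _).mp he
  have hK : (0 : ℤ) < ((2 * m + 1 : ℕ) : ℤ) := by positivity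
  rcases dvd_window2 hK hA (by push_cast; omega) (by push_cast; omega) with hA | hA | hA <;>
    (push_cast at hA; omega)

/-- `|Td m| = 4m`. [folklore] -/
theorem card_Td : (Td m).card = 4 * m := by
  have hK : (0 : ℤ) < ((2 * m + 1 : ℕ) : ℤ) := by positivity
  rw [Td, Finset.card_union_of_disjoint, Finset.card_image_of_injOn, Finset.card_image_of_injOn, Finset.card_range]
  · omega
  · intro i hi i' hi' he
    simp only [Finset.coe_range, Set.mem_Iio] at hi hi'
    obtain ⟨hA, -⟩ := (ref_eq_ref_iff _ _ _ _).mp he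
    rcases dvd_window2 hK hA (by push_cast; omega) (by push_cast; omega) with hA | hA | hA <;>
      (push_cast at hA; omega)
  · intro i hi i' hi' he
    simp only [Finset.coe_range, Set.mem_Iio] at hi hi'
    obtain ⟨hA, -⟩ := (rot_eq_rot_iff _ _ _ _).mp he
    rcases dvd_window2 hK hA (by push_cast; omega) (by push_cast; omega) with hA | hA | hA <;>
      (push_cast at hA; omega)
  · rw [Finset.disjoint_left]
    intro x hx hx'
    simp only [Finset.mem_image, Finset.mem_range] at hx hx'
    obtain ⟨j, -, rfl⟩ := hx
    obtain ⟨i, -, hc⟩ := hx'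
    simp at hc

/-- `|Ud m| = 2`. [folklore] -/
theorem card_Ud : (Ud m).card = 2 := by
  rw [Ud, Finset.card_pair]
  simp

set_option maxHeartbeats 0 in
/-- **The diagonal triple `(Sd m, Td m, Ud m)` has the triple product property** in `C_{2m+1} × D_{2(2m+1)}`. [folklore] -/
theorem tpp_diag :
    ∀ s ∈ Sd m, ∀ s' ∈ Sd m, ∀ t ∈ Td m, ∀ t' ∈ Td m, ∀ u ∈ Ud m, ∀ u' ∈ Ud m,
      s * s'⁻¹ * (t * t'⁻¹) * (u * u'⁻¹) = 1 → s = s' ∧ t = t' ∧ u = u' := by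
  have hK : (0 : ℤ) < ((2 * m + 1 : ℕ) : ℤ) := by positivity
  intro s hs s' hs' t ht t' ht' u hu u' hu' he
  simp only [Sd, Td, Ud, Finset.mem_image, Finset.mem_range, Finset.mem_union, Finset.mem_insert,
    Finset.mem_singleton] at hs hs' ht ht' hu hu'
  obtain ⟨i, hi, rfl⟩ := hs
  obtain ⟨i', hi', rfl⟩ := hs'
  rcases ht with ⟨x, hx, rfl⟩ | ⟨x, hx, rfl⟩ <;> rcases ht' with ⟨x', hx', rfl⟩ | ⟨x', hx', rfl⟩ <;>
  rcases hu with rfl | rfl <;> rcases hu' with rfl | rfl <;>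
  simp only [rot_mul_rot, rot_mul_ref, ref_mul_rot, ref_mul_ref, rot_inv, ref_inv, rot_eq_one_iff,
    ref_ne_one] at he
  all_goals (
    obtain ⟨hA, hB⟩ := he
    rcases dvd_window2 hK hA (by omega) (by omega) with hA | hA | hA <;>
    rcases dvd_window4 hK hB (by omega) (by omega) with hB | hB | hB | hB | hB | hB | hB <;>
    first
      | (exfalso; omega)
      | (obtain rfl : i = i' := by omega
         obtain rfl : x = x' := by omega
         exact ⟨rfl, rfl, rfl⟩))

/-- **The diagonal family**: for every odd `M = 2m+1`, `C_M × D_{2M}` realizes `⟨M, 2M−2, 2⟩` (volume `4M(M−1)`; vacuous for `m = 0`). -/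
theorem realizesTPP_diag :
    RealizesTPP (Grp (2 * m + 1) (2 * m + 1)) (2 * m + 1) (4 * m) 2 :=
  ⟨Sd m, Td m, Ud m, card_Sd m, card_Td m, card_Ud m, tpp_diag m⟩

/-- `TripleProductProperty` form of `tpp_diag`. [folklore] -/
theorem tripleProductProperty_diag : TripleProductProperty (Sd m) (Td m) (Ud m) := tpp_diag m

/-- Existence form: a TPP triple of sizes `(2m+1, 4m, 2)` in `C_{2m+1} × D_{2(2m+1)}`. [folklore] -/
theorem exists_tpp_diag : ∃ A B C : Finset (Grp (2 * m + 1) (2 * m + 1)),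
    TripleProductProperty A B C ∧ A.card = 2 * m + 1 ∧ B.card = 4 * m ∧ C.card = 2 :=
  ⟨Sd m, Td m, Ud m, tpp_diag m, card_Sd m, card_Td m, card_Ud m⟩

/-- Summary: `|G| = 2M²`, the triple has volume `M(2M−2)2 = 4M(M−1) = 2|G| − 4M`, so `β(C_M × D_{2M})/|G| ≥ 2 − 2/M`. -/
theorem diag_summary :
    Fintype.card (Grp (2 * m + 1) (2 * m + 1)) = 2 * (2 * m + 1) ^ 2 ∧
    RealizesTPP (Grp (2 * m + 1) (2 * m + 1)) (2 * m + 1) (4 * m) 2 ∧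
    (2 * m + 1) * (4 * m) * 2 + 4 * (2 * m + 1) = 2 * (2 * (2 * m + 1) ^ 2) :=
  ⟨by rw [card_Grp0]; ring, realizesTPP_diag m, by ring⟩

/-- ratio `→ 2` along the diagonal family: for every `n` some member has volume `· (n+1) > (2n+1) · |G|`. -/
theorem diag_ratio_approaches_two (n : ℕ) :
    ∃ m : ℕ, RealizesTPP (Grp (2 * m + 1) (2 * m + 1)) (2 * m + 1) (4 * m) 2 ∧
      (2 * n + 1) * Fintype.card (Grp (2 * m + 1) (2 * m + 1)) < (n + 1) * ((2 * m + 1) * (4 * m) * 2) := by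
  refine ⟨n + 1, realizesTPP_diag _, ?_⟩
  rw [card_Grp0]; nlinarith

end diag



end Summit.MatrixMultiplication.OmegaCensus.CyclicDihedralIndexTwoFamily
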